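import Summits.QuantumFields.YangMills.Theorems.UnitScaleTiltFluctuationComparisonRegPrGlobalSlackCanonicalOnChi
import Summits.QuantumFields.YangMills.Theorems.UnitScaleTiltFluctuationComparisonRegPrInteriorChi
import Summits.QuantumFields.YangMills.Theorems.UnitScaleTiltFluctuationComparisonRegPrOneStepSubmersion
import HarnessLib

/-!
# `UnitScaleTiltFluctuationComparisonRegPrGlobalSlackCanonicalOnChiIntL` — THE RE-TYPED ITEM `FluctuationComparisonRegPrIntL` FROM {STUB 1, 2′, T} AND THE χ-ROWS AT EVERY BLOCK SIZE
# (crux `FluctuationComparisonRegPrIntL`, stmt-QuantumFields-20520, skeleton v5k; width-lever lane B «(R1) print's χ of [Balaban1985UV3] (47) back», seat ym-ust-19935-r1 g2;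
# route-cone sibling of `…GlobalSlackCanonicalOnChi`, kept separate because it imports the route file through `…InteriorChi`)

Skeleton v5k composes `InteriorExcision.regPrIntL_of_innerChi` (★p2 g14, p539115) over FIVE stubs {STUB 1, 2′, 3⁗ (`L ≥ 7`, FULL-window slack row), (i)* (`L < 7`, slack row on
print's χ), T}.  Here the two analytic stubs 3⁗ and (i)* are REPLACED by the single hypothesis «the six chart rows of the K1a interface at the canonical polymerisation, the three
configuration-dependent rows read on print's χ, at every odd `L > 1` and every margin» (`GlobalSlackCanonicalOnChi.K1aChartRowsOnChi`): under interior excision nothing on the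
critical path reads the sharp window off χ, and no block-size floor `7 ≤ L` remains.  CONDITIONAL derivation of the route decl; it closes nothing by itself; nothing of
[Balaban1985UV3]/[King1986] is asserted.

References: T. Bałaban, CMP 102 (1985) 255–275 [Balaban1985UV3] ((41) p.266, (47) p.267, Thm 2 p.272); C. King, CMP 102 (1986) 649–677 [King1986] (Thm 3.4 (3.9) p.656,
Props. 3.8–3.9 pp.664–665); T. Bałaban, CMP 109 (1987) 249–301 [Balaban1987RG1] ((0.4) p.253).
-/

set_option autoImplicit false

noncomputable section

namespace Summit.QuantumFields.YangMills.Theorems.GlobalSlackCanonicalOnChi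

open MeasureTheory Filter
open Literature.MathematicalPhysics.QuantumFieldTheory.Balaban1983to89
open Literature.MathematicalPhysics.QuantumFieldTheory.Balaban1983to89.T3ContinuumYM3Torus
open Literature.MathematicalPhysics.QuantumFieldTheory.Balaban1983to89.T3UnitLawDensityEML (ℰp measurableE_ℰp)
open Literature.MathematicalPhysics.QuantumFieldTheory.Balaban1983to89.T3SmallLiftHistory
open Summit.QuantumFields.Balaban3D.Carriers
open Summit.QuantumFields.Balaban3D.Proofs.Primitives
open Summit.QuantumFields.YangMills.Theorems

/-- **THE RE-TYPED LOAD-BEARING ITEM `FluctuationComparisonRegPrIntL` FROM {STUB 1, 2′, T, THE χ-ROWS AT EVERY ODD BLOCK SIZE}** — skeleton v5k's composition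
(`InteriorExcision.regPrIntL_of_innerChi` p539115 ∘ STUB T, window positivity `OneStepSubmersion.posOnSmall_of_oneStepSmallLift` p446430 ∘ STUB 1) with its two analytic
stubs 3⁗ (`L ≥ 7`, FULL-window slack row) and (i)* (`L < 7`, slack row on χ) REPLACED by the single hypothesis «the six chart rows at the canonical polymerisation, the three
configuration rows read on print's χ, at every odd `L > 1` and every margin» (`innerAll_of_laneRecords_k1aChartRowsOnChi`).  A CONDITIONAL derivation of the route decl,
documenting that under interior excision nothing on the critical path reads the sharp window off χ and no block-size floor `7 ≤ L` remains; it closes nothing by itself.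
[cite: Balaban1985UV3, (41) p.266, (47) p.267, Thm 2 p.272; King1986, Thm 3.4 (3.9) p.656, Props. 3.8-3.9 pp.664-665; Balaban1987RG1, (0.4) p.253] -/
theorem regPrIntL_of_laneRecords_thm1_k1aChartRowsOnChi
    (h1 : ∀ L : ℕ, ∃ κ δ₀ : ℝ, κ * Real.sqrt L ≤ 1 ∧ 0 < δ₀ ∧ ∀ F : T3Family, F.L = L → OneStepSmallLift F ℰp κ δ₀)
    (h2 : ∀ L : ℕ, Odd L → 1 < L → Summit.QuantumFields.YangMills.Theorems.AlphaInputsT3ACv3Rec L)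
    (hT : ∀ L : ℕ, Odd L → 1 < L → T3PrintedMinimiserExistence.Thm1GlobalMin L)
    (hχ : ∀ (L : ℕ), Odd L → 1 < L → ∀ (μ : ℝ), 0 < μ → μ < 1 → ∀ (𝔠 : AlphaConsts L (suGroupModel 2).N) (a₀ a₁ : ℝ),
      0 < a₀ → 0 < a₁ → 𝔠.B₃ * a₁ ≤ a₀ → ∃ a : ℝ, 0 < a ∧ a < 1 ∧ K1aChartRowsOnChi L μ 𝔠 a₀ a₁ a) :
    Summit.QuantumFields.YangMills.Theses.UnitScaleTilt.FluctuationComparisonRegPrIntL :=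
  InteriorExcision.regPrIntL_of_innerChi hT (innerAll_of_laneRecords_k1aChartRowsOnChi h2 hχ)
    (OneStepSubmersion.posOnSmall_of_oneStepSmallLift h1)

end Summit.QuantumFields.YangMills.Theorems.GlobalSlackCanonicalOnChi

end
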